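import Summits.AnomalousDissipation.AnomalousDissipation.Theorems.MomentParityQuarticGateFourierDictionary
import Summits.AnomalousDissipation.AnomalousDissipation.Theorems.MomentParityQuarticGatePairCalculus

/-!
# Axial quadratic rigidity (stub S2q of line `axis-sectors`, crux `MomentParity.QuarticGate`):
# real versus complex pairings of coefficient families

The Fourier dictionary (`…FourierDictionary`) expresses pairings and Euler brackets of level-`N`
fields as REAL sums `Σ_k Re ⟪c k, G k⟫_ℂ` over symmetric frequency sets, for conjugate-symmetric
families. For the complexified (one-sided) probes of the algebraic core these must be rewritten as
COMPLEX-bilinear sums `Σ_k c(k) · G(-k)` (bilinear dot product of `Fin 3 → ℂ`):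

* `ofReal_sum_re_eq_sum` — a sum of real parts of a conjugate-symmetric summand over a symmetric set
  is the (real) complex sum;
* `pairingSum_eq`, `bracketSum_eq` — the two conversions used for the observable and the bracket;
* admissible families: `Pi.single` probes are transversal and supported, admissible families add,
  and every transversal supported family splits as `x' + I • x''` with `x', x''` conjugate
  symmetric, transversal and supported (`exists_conjSymm_decomposition`).
-/

namespace Summit.AnomalousDissipation.AnomalousDissipation.Theorems.MomentParityQuarticGate.AxialQuad

open scoped InnerProductSpace ComplexConjugate
open Literature.Analysis.FunctionSpaces Literature.Analysis.FluidPDE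

-- `Summit.<Summit>.<Problem>` is the tree's mandated summit-side namespace (CONVENTIONS §2); for this
-- single-conjunct summit the two coincide, so the duplicate is deliberate.
set_option linter.dupNamespace false

noncomputable section

/-! ## Reality of symmetric sums -/

section Reality

/-- **A symmetric sum of a conjugate-symmetric summand is real**: `Σ_{k∈T} Re f(k) = Σ_{k∈T} f(k)` in
`ℂ` when `-T = T` and `f(-k) = conj f(k)`. [folklore] -/
theorem ofReal_sum_re_eq_sum {T : Finset (Fin 3 → ℤ)} (hT : ∀ k ∈ T, -k ∈ T) (f : (Fin 3 → ℤ) → ℂ)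
    (hf : ∀ k, f (-k) = conj (f k)) : (((∑ k ∈ T, (f k).re : ℝ)) : ℂ) = ∑ k ∈ T, f k := by
  have hreal : conj (∑ k ∈ T, f k) = ∑ k ∈ T, f k := by
    rw [map_sum]
    calc ∑ k ∈ T, conj (f k) = ∑ k ∈ T, f (-k) := Finset.sum_congr rfl fun k _ => (hf k).symm
      _ = ∑ k ∈ T, f k := Finset.sum_nbij' (fun k => -k) (fun k => -k) (fun k hk => hT k hk)
          (fun k hk => hT k hk) (fun k _ => neg_neg k) (fun k _ => neg_neg k) fun k _ => rfl
  have h := Complex.conj_eq_iff_re.1 hreal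
  rwa [Complex.re_sum] at h

/-- `star` of the coordinates is the coordinates of the conjugate vector. [folklore] -/
theorem star_ofLp (v : EuclideanSpace ℂ (Fin 3)) :
    star (WithLp.ofLp v) = WithLp.ofLp (EuclideanSpace.conjVec v) := by
  funext i; simp [EuclideanSpace.conjVec]

/-- Conjugating both arguments conjugates the inner product. [folklore] -/
theorem inner_conjVec_conjVec (x y : EuclideanSpace ℂ (Fin 3)) :
    inner ℂ (EuclideanSpace.conjVec x) (EuclideanSpace.conjVec y) = conj (inner ℂ x y) := by
  rw [EuclideanSpace.inner_eq_star_dotProduct, EuclideanSpace.inner_eq_star_dotProduct, star_ofLp,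
    star_ofLp, EuclideanSpace.conjVec_conjVec]
  simp only [dotProduct, map_sum, map_mul]
  refine Finset.sum_congr rfl fun i _ => ?_
  rw [show (EuclideanSpace.conjVec y).ofLp i = conj (y.ofLp i) from rfl,
    show (EuclideanSpace.conjVec x).ofLp i = conj (x.ofLp i) from rfl, Complex.conj_conj]

/-- **The inner product through conjugate symmetry**: `⟪c k, w⟫_ℂ = c(-k) · w` (bilinear dot
product) for a conjugate-symmetric family `c`. [folklore] -/
theorem inner_eq_dotProduct_of_isConjSymm {c : (Fin 3 → ℤ) → EuclideanSpace ℂ (Fin 3)}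
    (hc : Torus.IsConjSymm c) (k : Fin 3 → ℤ) (w : EuclideanSpace ℂ (Fin 3)) :
    inner ℂ (c k) w = WithLp.ofLp (c (-k)) ⬝ᵥ WithLp.ofLp w := by
  rw [EuclideanSpace.inner_eq_star_dotProduct, dotProduct_comm, star_ofLp, ← hc k]

/-- **The observable's pairing, complex form**: for conjugate-symmetric `c, G` on a symmetric `T`,
`Σ_{k∈T} Re ⟪c k, G k⟫ = Σ_{k∈T} c(k) · G(-k)`. [folklore] -/
theorem pairingSum_eq {T : Finset (Fin 3 → ℤ)} (hT : ∀ k ∈ T, -k ∈ T)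
    {c G : (Fin 3 → ℤ) → EuclideanSpace ℂ (Fin 3)} (hc : Torus.IsConjSymm c) (hG : Torus.IsConjSymm G) :
    (((∑ k ∈ T, (inner ℂ (c k) (G k)).re : ℝ)) : ℂ) =
      ∑ k ∈ T, WithLp.ofLp (c k) ⬝ᵥ WithLp.ofLp (G (-k)) := by
  rw [ofReal_sum_re_eq_sum hT _ (fun k => by rw [hc k, hG k, inner_conjVec_conjVec])]
  calc ∑ k ∈ T, inner ℂ (c k) (G k) = ∑ k ∈ T, WithLp.ofLp (c (-k)) ⬝ᵥ WithLp.ofLp (G k) :=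
        Finset.sum_congr rfl fun k _ => inner_eq_dotProduct_of_isConjSymm hc k _
    _ = ∑ k ∈ T, WithLp.ofLp (c k) ⬝ᵥ WithLp.ofLp (G (-k)) :=
        Finset.sum_nbij' (fun k => -k) (fun k => -k) (fun k hk => hT k hk) (fun k hk => hT k hk)
          (fun k _ => neg_neg k) (fun k _ => neg_neg k) fun k _ => by rw [neg_neg]

/-- **The bracket's pairing, complex form**: `Σ_{k∈T} Re ⟪B k, c k⟫ = Σ_{k∈T} B(-k) · c(k)` for
conjugate-symmetric `B, c` on a symmetric `T`. [folklore] -/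
theorem bracketSum_eq {T : Finset (Fin 3 → ℤ)} (hT : ∀ k ∈ T, -k ∈ T)
    {B c : (Fin 3 → ℤ) → EuclideanSpace ℂ (Fin 3)} (hB : Torus.IsConjSymm B) (hc : Torus.IsConjSymm c) :
    (((∑ k ∈ T, (inner ℂ (B k) (c k)).re : ℝ)) : ℂ) =
      ∑ k ∈ T, WithLp.ofLp (B (-k)) ⬝ᵥ WithLp.ofLp (c k) := by
  rw [ofReal_sum_re_eq_sum hT _ (fun k => by rw [hB k, hc k, inner_conjVec_conjVec])]
  exact Finset.sum_congr rfl fun k _ => inner_eq_dotProduct_of_isConjSymm hB k _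

/-- `pairingSum_eq` with the casts inside the sum. [folklore] -/
theorem pairingSum_eq' {T : Finset (Fin 3 → ℤ)} (hT : ∀ k ∈ T, -k ∈ T)
    {c G : (Fin 3 → ℤ) → EuclideanSpace ℂ (Fin 3)} (hc : Torus.IsConjSymm c) (hG : Torus.IsConjSymm G) :
    ∑ k ∈ T, (((inner ℂ (c k) (G k)).re : ℝ) : ℂ) = ∑ k ∈ T, WithLp.ofLp (c k) ⬝ᵥ WithLp.ofLp (G (-k)) := by
  rw [← Complex.ofReal_sum]; exact pairingSum_eq hT hc hG

/-- `bracketSum_eq` with the casts inside the sum. [folklore] -/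
theorem bracketSum_eq' {T : Finset (Fin 3 → ℤ)} (hT : ∀ k ∈ T, -k ∈ T)
    {B c : (Fin 3 → ℤ) → EuclideanSpace ℂ (Fin 3)} (hB : Torus.IsConjSymm B) (hc : Torus.IsConjSymm c) :
    ∑ k ∈ T, (((inner ℂ (B k) (c k)).re : ℝ) : ℂ) = ∑ k ∈ T, WithLp.ofLp (B (-k)) ⬝ᵥ WithLp.ofLp (c k) := by
  rw [← Complex.ofReal_sum]; exact bracketSum_eq hT hB hc

end Reality

/-! ## Admissible and one-sided coefficient families -/

section Families

/-- **One-sided probes are transversal**: `δ_{k₀} v` with `k₀ · v = 0`. [folklore] -/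
theorem isTransversal_single (S : Finset (Fin 3 → ℤ)) {k₀ : Fin 3 → ℤ} {v : EuclideanSpace ℂ (Fin 3)}
    (hv : ∑ j, (k₀ j : ℂ) * v j = 0) :
    Torus.IsTransversal S (Pi.single k₀ v : (Fin 3 → ℤ) → EuclideanSpace ℂ (Fin 3)) := by
  intro k _
  by_cases h : k = k₀
  · subst h; simpa using hv
  · simp [Pi.single_eq_of_ne h]

/-- One-sided probes at `k₀ ∈ S` are supported in `S`. [folklore] -/
theorem single_eq_zero_of_not_mem {S : Finset (Fin 3 → ℤ)} {k₀ : Fin 3 → ℤ} (hk₀ : k₀ ∈ S)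
    (v : EuclideanSpace ℂ (Fin 3)) :
    ∀ k ∉ S, (Pi.single k₀ v : (Fin 3 → ℤ) → EuclideanSpace ℂ (Fin 3)) k = 0 :=
  fun _ hk => Pi.single_eq_of_ne (fun h => hk (by rw [h]; exact hk₀)) _

/-- Supported families add. [folklore] -/
theorem add_eq_zero_of_not_mem {S : Finset (Fin 3 → ℤ)} {c c' : (Fin 3 → ℤ) → EuclideanSpace ℂ (Fin 3)}
    (hc : ∀ k ∉ S, c k = 0) (hc' : ∀ k ∉ S, c' k = 0) : ∀ k ∉ S, (c + c') k = 0 := fun k hk => by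
  simp [hc k hk, hc' k hk]

/-- **Admissible families are closed under addition** (conjugate symmetry, transversality,
support). [folklore] -/
theorem admissible_add {S : Finset (Fin 3 → ℤ)} {c c' : (Fin 3 → ℤ) → EuclideanSpace ℂ (Fin 3)}
    (hc : Torus.IsConjSymm c ∧ Torus.IsTransversal S c ∧ ∀ k ∉ S, c k = 0)
    (hc' : Torus.IsConjSymm c' ∧ Torus.IsTransversal S c' ∧ ∀ k ∉ S, c' k = 0) :
    Torus.IsConjSymm (c + c') ∧ Torus.IsTransversal S (c + c') ∧ ∀ k ∉ S, (c + c') k = 0 :=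
  ⟨hc.1.add hc'.1, isTransversal_add hc.2.1 hc'.2.1, add_eq_zero_of_not_mem hc.2.2 hc'.2.2⟩

/-- **Real and imaginary parts of a family.** Every family `x` transversal on and supported in a
symmetric `S` is `x' + I • x''` with `x', x''` conjugate symmetric, transversal on and supported in
`S`: `x' = ½ (x + Cx)`, `x'' = -I/2 (x - Cx)`, `(Cx)(k) = conj x(-k)`. [folklore] -/
theorem exists_conjSymm_decomposition {S : Finset (Fin 3 → ℤ)} (hS : ∀ k ∈ S, -k ∈ S)
    {x : (Fin 3 → ℤ) → EuclideanSpace ℂ (Fin 3)} (hxT : Torus.IsTransversal S x)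
    (hxs : ∀ k ∉ S, x k = 0) :
    ∃ x' ∈ {c : (Fin 3 → ℤ) → EuclideanSpace ℂ (Fin 3) |
        Torus.IsConjSymm c ∧ Torus.IsTransversal S c ∧ ∀ k ∉ S, c k = 0},
      ∃ x'' ∈ {c : (Fin 3 → ℤ) → EuclideanSpace ℂ (Fin 3) |
        Torus.IsConjSymm c ∧ Torus.IsTransversal S c ∧ ∀ k ∉ S, c k = 0},
      x = x' + Complex.I • x'' := by
  have hnS : ∀ k ∉ S, -k ∉ S := fun k hk h => hk (by simpa using hS (-k) h)
  -- transversality of the reflected family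
  have hrefl : ∀ k ∈ S, ∑ j, (k j : ℂ) * (EuclideanSpace.conjVec (x (-k))) j = 0 := by
    intro k hk
    have h := congrArg conj (hxT (-k) (hS k hk))
    rw [map_sum, map_zero] at h
    rw [← neg_eq_zero, ← h, ← Finset.sum_neg_distrib]
    refine Finset.sum_congr rfl fun j _ => ?_
    simp only [EuclideanSpace.conjVec_apply, map_mul, Pi.neg_apply, Int.cast_neg, map_neg, map_intCast]
    ring
  refine ⟨fun k => (2 : ℂ)⁻¹ • (x k + EuclideanSpace.conjVec (x (-k))), ⟨?_, ?_, ?_⟩,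
    fun k => (-Complex.I / 2) • (x k - EuclideanSpace.conjVec (x (-k))), ⟨?_, ?_, ?_⟩, ?_⟩
  · intro k
    dsimp only
    rw [neg_neg, EuclideanSpace.conjVec_smul, EuclideanSpace.conjVec_add, EuclideanSpace.conjVec_conjVec,
      add_comm (EuclideanSpace.conjVec (x k)), map_inv₀, Complex.conj_ofNat]
  · intro k hk
    have h1 := hxT k hk
    have h2 := hrefl k hk
    simp only [PiLp.smul_apply, PiLp.add_apply, smul_eq_mul] at h1 h2 ⊢
    calc ∑ j, (k j : ℂ) * (2⁻¹ * (x k j + EuclideanSpace.conjVec (x (-k)) j))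
        = 2⁻¹ * (∑ j, (k j : ℂ) * x k j + ∑ j, (k j : ℂ) * EuclideanSpace.conjVec (x (-k)) j) := by
          rw [← Finset.sum_add_distrib, Finset.mul_sum]
          exact Finset.sum_congr rfl fun j _ => by ring
      _ = 0 := by rw [h1, h2, add_zero, mul_zero]
  · intro k hk
    simp [hxs k hk, hxs (-k) (hnS k hk)]
  · intro k
    dsimp only
    rw [neg_neg, EuclideanSpace.conjVec_smul, EuclideanSpace.conjVec_sub, EuclideanSpace.conjVec_conjVec,
      map_div₀, map_neg, Complex.conj_I, neg_neg, Complex.conj_ofNat]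
    rw [show x (-k) - EuclideanSpace.conjVec (x k) = -(EuclideanSpace.conjVec (x k) - x (-k)) by abel,
      smul_neg, ← neg_smul, neg_div, neg_neg]
  · intro k hk
    have h1 := hxT k hk
    have h2 := hrefl k hk
    simp only [PiLp.smul_apply, PiLp.sub_apply, smul_eq_mul] at h1 h2 ⊢
    calc ∑ j, (k j : ℂ) * (-Complex.I / 2 * (x k j - EuclideanSpace.conjVec (x (-k)) j))
        = -Complex.I / 2 * (∑ j, (k j : ℂ) * x k j - ∑ j, (k j : ℂ) * EuclideanSpace.conjVec (x (-k)) j) := by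
          rw [← Finset.sum_sub_distrib, Finset.mul_sum]
          exact Finset.sum_congr rfl fun j _ => by ring
      _ = 0 := by rw [h1, h2, sub_zero, mul_zero]
  · intro k hk
    simp [hxs k hk, hxs (-k) (hnS k hk)]
  · funext k
    ext j
    simp only [Pi.add_apply, Pi.smul_apply, PiLp.add_apply, PiLp.smul_apply, PiLp.sub_apply, smul_eq_mul]
    have hI : Complex.I * Complex.I = -1 := Complex.I_mul_I
    linear_combination (2⁻¹ * (x k j - EuclideanSpace.conjVec (x (-k)) j)) * hI

end Families

end

end Summit.AnomalousDissipation.AnomalousDissipation.Theorems.MomentParityQuarticGate.AxialQuad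

namespace Summit.AnomalousDissipation.AnomalousDissipation.Theorems.MomentParityQuarticGate

open Literature.Analysis.FunctionSpaces Literature.Analysis.FluidPDE
open Summit.AnomalousDissipation.AnomalousDissipation.Theorems.QuarticGate.Negative

-- the summit-side namespace repeats `AnomalousDissipation` by the tree's convention
set_option linter.dupNamespace false in
/-- **Registered sub-goal `axialQuad_pairingSum` of stub S2q** (summary of this file): the real pairing sum of two conjugate-symmetric families over a symmetric set is the complex bilinear sum `Σ c(k) · G(-k)`. [folklore] -/
theorem axialQuad_pairingSum : ∀ (T : Finset (Fin 3 → ℤ)), (∀ k ∈ T, -k ∈ T) → ∀ (c G : (Fin 3 → ℤ) → EuclideanSpace ℂ (Fin 3)), Torus.IsConjSymm c → Torus.IsConjSymm G → ∑ k ∈ T, (((inner ℂ (c k) (G k)).re : ℝ) : ℂ) = ∑ k ∈ T, WithLp.ofLp (c k) ⬝ᵥ WithLp.ofLp (G (-k)) :=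
  fun _ hT _ _ hc hG => AxialQuad.pairingSum_eq' hT hc hG

end Summit.AnomalousDissipation.AnomalousDissipation.Theorems.MomentParityQuarticGate
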